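import Summits.SmoothPoincare4.SmoothPoincare4.Theorems.CongruenceShadowsShadowApproximationStubGoeritzThreeRealisers

/-!
# Helper II for stub `stub_goeritzRealisationThree` (line `nilpotent-genus-class`, crux
`CongruenceShadows.ShadowApproximation`, item stmt-SmoothPoincare4-14595): Goeritz realisers at genus 3,
continued

Sequel to `…StubGoeritzThreeRealisers.lean` (same setting and tools: `S₃`, `N₀ = ⟪a₀,a₁,b₂⟫`,
`N₁ = ⟪a₀,b₁,a₂⟫`, kernels by erasure, homology by exponent sums, everything by `decide`).  Realisers:
* `z02` (Zieschang–Vogt–Coldewey's type (C) automorphism `α`, 3.6.9 (C), on the handles `2, 0`,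
  normalised to fix the relator): `moveZ 0 2 1` (`a₂ ↦ a₂ + a₀`, `b₀ ↦ b₀ - b₂`);
* `x0` (the Dehn twist about `a₀`, `b₀ ↦ b₀a₀`, cf. `twA` of `Negative/UnitTwist.lean`): `moveX 0 1`;
* `eps k` (`a ↦ (ab)a⁻¹(ab)⁻¹`, `b ↦ (ab)b⁻¹(ab)⁻¹` on handle `k`, fixing `[a_k,b_k]` on the nose):
  the handle sign `negHandle k` (`a_k, b_k ↦ -a_k, -b_k`), for all three `k` at once;
* `iotaEquiv` — the REFLECTION `ι : aᵢ ↦ wᵢaᵢwᵢ⁻¹`, `bᵢ ↦ wᵢbᵢ⁻¹wᵢ⁻¹` (`w₀ = c₂⁻¹c₁⁻¹b₀`,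
  `w₁ = c₂⁻¹b₁`, `w₂ = b₂`, `cᵢ = [aᵢ,bᵢ]`; found by the crux disprover): it sends the relator to its
  INVERSE on the nose and squares to the identity of the free group, so it is an (orientation-
  reversing) involution of `S₃`; it stabilises `N₀, N₁` (and `N₂`) and acts on `H₁` by `negB`
  (`bᵢ ↦ -bᵢ`), which negates the intersection form.
With Helper I this realises every generator of the integral pair-stabiliser
`Stab_{Sp^±(6,ℤ)}(Λ₀,Λ₁)`; the reduction of the stabiliser to these generators is
`…StubGoeritzThreeReduction.lean`.

## References

* H. Zieschang, E. Vogt, H.-D. Coldewey, *Surfaces and Planar Discontinuous Groups*, LNM 835,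
  Springer (1980), §3.6, 3.6.9 (A)–(D). [ZieschangVogtColdewey1980]
-/

-- the prescribed namespace `Summit.<P>.<Sub>.…` duplicates `SmoothPoincare4` (P = Sub)
set_option linter.dupNamespace false
noncomputable section
open Literature.Topology.FourManifolds Multiplicative

namespace Summit.SmoothPoincare4.SmoothPoincare4.Theorems.ShadowApproximation.NilpotentGenusClass

/-- `Goeritz⟪σ, f⟫`: `σ` stabilises `N₀` and `N₁` and induces `f` on `H₁` (file-local notation, as in
Helper I). -/
local notation3 "Goeritz⟪" σ ", " f "⟫" =>
  Subgroup.map (MulEquiv.toMonoidHom (σ : SurfaceGroup 3 ≃* SurfaceGroup 3)) (s4Kernels 0) =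
      s4Kernels 0 ∧
    Subgroup.map (MulEquiv.toMonoidHom (σ : SurfaceGroup 3 ≃* SurfaceGroup 3)) (s4Kernels 1) =
      s4Kernels 1 ∧
    ∀ s : SurfaceGroup 3, toAdd (SurfaceGroup.abelianize 3 ((σ : SurfaceGroup 3 ≃* SurfaceGroup 3) s)) =
      (f : (surfaceGen 3 → ℤ) ≃ₗ[ℤ] (surfaceGen 3 → ℤ)) (toAdd (SurfaceGroup.abelianize 3 s))

/-! ## Type (C) on handles `0, 2`, and the twist about `a₀` -/
/-- Generator images of `z02`: `a0 ↦ b2 a0 B2`, `b0 ↦ b2 A0 B2 a0 b0 B2`, `a1 ↦ b2 A0 B2 a0 a1 A0 b2 a0 B2`, `b1 ↦ b2 A0 B2 a0 b1 A0 b2 a0 B2`, `a2 ↦ b2 A0 B2 a0 a2 b2 a0 B2`, `b2 ↦ b2 A0 b2 a0 B2`. [folklore] -/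
def z02Fun (x : surfaceGen 3) : FreeGroup (surfaceGen 3) :=
  if x = ((0 : Fin 3), false) then
    genB 2 * genA 0 * (genB 2)⁻¹
  else if x = ((0 : Fin 3), true) then
    genB 2 * (genA 0)⁻¹ * (genB 2)⁻¹ * genA 0 * genB 0 * (genB 2)⁻¹
  else if x = ((1 : Fin 3), false) then
    genB 2 * (genA 0)⁻¹ * (genB 2)⁻¹ * genA 0 * genA 1 * (genA 0)⁻¹ * genB 2 * genA 0 * (genB 2)⁻¹
  else if x = ((1 : Fin 3), true) then
    genB 2 * (genA 0)⁻¹ * (genB 2)⁻¹ * genA 0 * genB 1 * (genA 0)⁻¹ * genB 2 * genA 0 * (genB 2)⁻¹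
  else if x = ((2 : Fin 3), false) then
    genB 2 * (genA 0)⁻¹ * (genB 2)⁻¹ * genA 0 * genA 2 * genB 2 * genA 0 * (genB 2)⁻¹
  else if x = ((2 : Fin 3), true) then
    genB 2 * (genA 0)⁻¹ * genB 2 * genA 0 * (genB 2)⁻¹
  else FreeGroup.of x

/-- Generator images of `z02⁻¹`: `a0 ↦ a0 B2 a0 b2 A0`, `b0 ↦ a0 B2 A0 b2 b0 a0 b2 A0`, `a1 ↦ a0 B2 A0 b2 a1 B2 a0 b2 A0`, `b1 ↦ a0 B2 A0 b2 b1 B2 a0 b2 A0`, `a2 ↦ a0 B2 A0 b2 a2 A0`, `b2 ↦ a0 b2 A0`. [folklore] -/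
def z02Inv (x : surfaceGen 3) : FreeGroup (surfaceGen 3) :=
  if x = ((0 : Fin 3), false) then
    genA 0 * (genB 2)⁻¹ * genA 0 * genB 2 * (genA 0)⁻¹
  else if x = ((0 : Fin 3), true) then
    genA 0 * (genB 2)⁻¹ * (genA 0)⁻¹ * genB 2 * genB 0 * genA 0 * genB 2 * (genA 0)⁻¹
  else if x = ((1 : Fin 3), false) then
    genA 0 * (genB 2)⁻¹ * (genA 0)⁻¹ * genB 2 * genA 1 * (genB 2)⁻¹ * genA 0 * genB 2 * (genA 0)⁻¹
  else if x = ((1 : Fin 3), true) then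
    genA 0 * (genB 2)⁻¹ * (genA 0)⁻¹ * genB 2 * genB 1 * (genB 2)⁻¹ * genA 0 * genB 2 * (genA 0)⁻¹
  else if x = ((2 : Fin 3), false) then
    genA 0 * (genB 2)⁻¹ * (genA 0)⁻¹ * genB 2 * genA 2 * (genA 0)⁻¹
  else if x = ((2 : Fin 3), true) then
    genA 0 * genB 2 * (genA 0)⁻¹
  else FreeGroup.of x

/-- **Type (C) on handles `0, 2`**: Zieschang–Vogt–Coldewey's `α` (3.6.9 (C)) with `(tⱼ,uⱼ) = (a₂,b₂)`, `(tᵢ,uᵢ) = (a₀,b₀)`, normalised to fix the relator, as a relator-fixing automorphism of `S₃` (all four free-group identities by `decide`).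
[folklore] -/
def z02 : RelatorAut 3 :=
  RelatorAut.ofGens z02Fun z02Inv (by decide) (by decide) (by decide) (by decide)

/-- **`z02` is a Goeritz element realising `moveZ 0 2 1` (`a₂ ↦ a₂ + a₀`, `b₀ ↦ b₀ - b₂`)`** (kernels by erasure, homology by exponent
sums, both by `decide`). [folklore] -/
theorem z02_goeritz : Goeritz⟪z02.toMulEquiv, moveZ 0 2 (by decide) 1⟫ :=
  goeritz_of_decide z02 _ (by decide) (by decide) (by decide) (by decide) (by decide)
/-- Generator images of `x0`: `b0 ↦ b0 a0`. [folklore] -/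
def x0Fun (x : surfaceGen 3) : FreeGroup (surfaceGen 3) :=
  if x = ((0 : Fin 3), true) then
    genB 0 * genA 0
  else FreeGroup.of x

/-- Generator images of `x0⁻¹`: `b0 ↦ b0 A0`. [folklore] -/
def x0Inv (x : surfaceGen 3) : FreeGroup (surfaceGen 3) :=
  if x = ((0 : Fin 3), true) then
    genB 0 * (genA 0)⁻¹
  else FreeGroup.of x

/-- **The Dehn twist about `a₀`** (`b₀ ↦ b₀a₀`; it fixes `[a₀,b₀]` on the nose), as a relator-fixing automorphism of `S₃` (all four free-group identities by `decide`).
[folklore] -/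
def x0 : RelatorAut 3 :=
  RelatorAut.ofGens x0Fun x0Inv (by decide) (by decide) (by decide) (by decide)

/-- **`x0` is a Goeritz element realising `moveX 0 1` (`b₀ ↦ b₀ + a₀`)`** (kernels by erasure, homology by exponent
sums, both by `decide`). [folklore] -/
theorem x0_goeritz : Goeritz⟪x0.toMulEquiv, moveX 0 1⟫ :=
  goeritz_of_decide x0 _ (by decide) (by decide) (by decide) (by decide) (by decide)

/-! ## The handle signs `eps k` -/

/-- Generator images of `eps k`: `a_k ↦ (a_kb_k)a_k⁻¹(a_kb_k)⁻¹`, `b_k ↦ (a_kb_k)b_k⁻¹(a_kb_k)⁻¹`,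
the other generators fixed. [folklore] -/
def epsFun (k : Fin 3) (x : surfaceGen 3) : FreeGroup (surfaceGen 3) :=
  if x = (k, false) then genA k * genB k * (genA k)⁻¹ * (genB k)⁻¹ * (genA k)⁻¹
  else if x = (k, true) then genA k * (genB k)⁻¹ * (genA k)⁻¹
  else FreeGroup.of x

/-- Generator images of `(eps k)⁻¹`: `a_k ↦ (b_ka_k)a_k⁻¹(b_ka_k)⁻¹`, `b_k ↦ (b_ka_k)b_k⁻¹(b_ka_k)⁻¹`.
[folklore] -/
def epsInv (k : Fin 3) (x : surfaceGen 3) : FreeGroup (surfaceGen 3) :=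
  if x = (k, false) then genB k * (genA k)⁻¹ * (genB k)⁻¹
  else if x = (k, true) then genB k * genA k * (genB k)⁻¹ * (genA k)⁻¹ * (genB k)⁻¹
  else FreeGroup.of x

/-- `eps k` fixes the relator. [folklore] -/
theorem epsFun_rel : ∀ k : Fin 3, FreeGroup.lift (epsFun k) (surfaceRelator 3) = surfaceRelator 3 := by
  decide

/-- `(eps k)⁻¹` fixes the relator. [folklore] -/
theorem epsInv_rel : ∀ k : Fin 3, FreeGroup.lift (epsInv k) (surfaceRelator 3) = surfaceRelator 3 := by
  decide

/-- `(eps k)⁻¹ ∘ eps k = id` on generators. [folklore] -/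
theorem epsInv_epsFun : ∀ (k : Fin 3) (x : surfaceGen 3),
    FreeGroup.lift (epsInv k) (epsFun k x) = FreeGroup.of x := by
  decide

/-- `eps k ∘ (eps k)⁻¹ = id` on generators. [folklore] -/
theorem epsFun_epsInv : ∀ (k : Fin 3) (x : surfaceGen 3),
    FreeGroup.lift (epsFun k) (epsInv k x) = FreeGroup.of x := by
  decide

/-- **The handle sign `eps k`** as a relator-fixing automorphism of `S₃`. [folklore] -/
def eps (k : Fin 3) : RelatorAut 3 :=
  RelatorAut.ofGens (epsFun k) (epsInv k) (epsFun_rel k) (epsInv_rel k) (epsInv_epsFun k)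
    (epsFun_epsInv k)

/-- Erasure test for `eps k`, cut system `0`, images. [folklore] -/
theorem eps_erase0 : ∀ k : Fin 3,
    ∀ p ∈ s4Gens 0, FreeGroup.lift (eraseGen (s4Gens 0)) ((eps k).hom (FreeGroup.of p)) = 1 := by
  decide

/-- Erasure test for `eps k`, cut system `0`, inverse images. [folklore] -/
theorem eps_erase0' : ∀ k : Fin 3,
    ∀ p ∈ s4Gens 0, FreeGroup.lift (eraseGen (s4Gens 0)) ((eps k).inv (FreeGroup.of p)) = 1 := by
  decide

/-- Erasure test for `eps k`, cut system `1`, images. [folklore] -/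
theorem eps_erase1 : ∀ k : Fin 3,
    ∀ p ∈ s4Gens 1, FreeGroup.lift (eraseGen (s4Gens 1)) ((eps k).hom (FreeGroup.of p)) = 1 := by
  decide

/-- Erasure test for `eps k`, cut system `1`, inverse images. [folklore] -/
theorem eps_erase1' : ∀ k : Fin 3,
    ∀ p ∈ s4Gens 1, FreeGroup.lift (eraseGen (s4Gens 1)) ((eps k).inv (FreeGroup.of p)) = 1 := by
  decide

/-- Exponent sums for `eps k`: it induces `negHandle k`. [folklore] -/
theorem eps_expSum : ∀ (k : Fin 3) (x : surfaceGen 3),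
    toAdd (FreeGroup.lift (fun y : surfaceGen 3 => ofAdd (Pi.single y (1 : ℤ)))
      ((eps k).hom (FreeGroup.of x))) = negHandle k (Pi.single x 1) := by
  decide

/-- **`eps k` is a Goeritz element realising the handle sign `negHandle k`** (`a_k, b_k ↦ -a_k, -b_k`).
[folklore] -/
theorem eps_goeritz (k : Fin 3) : Goeritz⟪(eps k).toMulEquiv, negHandle k⟫ :=
  goeritz_of_decide (eps k) _ (eps_erase0 k) (eps_erase0' k) (eps_erase1 k) (eps_erase1' k)
    (eps_expSum k)

/-! ## The reflection `ι` -/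

/-- The commutator word `cᵢ = aᵢbᵢaᵢ⁻¹bᵢ⁻¹`. [folklore] -/
def cw (i : Fin 3) : FreeGroup (surfaceGen 3) := genA i * genB i * (genA i)⁻¹ * (genB i)⁻¹

/-- The conjugators of `ι`: `w₀ = c₂⁻¹c₁⁻¹b₀`, `w₁ = c₂⁻¹b₁`, `w₂ = b₂`. [folklore] -/
def iotaW (i : Fin 3) : FreeGroup (surfaceGen 3) :=
  if i = 0 then (cw 2)⁻¹ * (cw 1)⁻¹ * genB 0 else if i = 1 then (cw 2)⁻¹ * genB 1 else genB 2

/-- Generator images of `ι`: `aᵢ ↦ wᵢaᵢwᵢ⁻¹`, `bᵢ ↦ wᵢbᵢ⁻¹wᵢ⁻¹`. [folklore] -/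
def iotaFun (x : surfaceGen 3) : FreeGroup (surfaceGen 3) :=
  if x.2 = true then iotaW x.1 * (FreeGroup.of x)⁻¹ * (iotaW x.1)⁻¹
  else iotaW x.1 * FreeGroup.of x * (iotaW x.1)⁻¹

/-- `ι` sends the relator to its inverse, on the nose. [folklore] -/
theorem iotaFun_rel : FreeGroup.lift iotaFun (surfaceRelator 3) = (surfaceRelator 3)⁻¹ := by
  decide

/-- `ι ∘ ι = id` on generators (in the free group). [folklore] -/
theorem iotaFun_iotaFun : ∀ x : surfaceGen 3, FreeGroup.lift iotaFun (iotaFun x) = FreeGroup.of x := by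
  decide

/-- `ι` as an endomorphism of `S₃` (the relator goes to `r⁻¹`, which dies). [folklore] -/
def iotaHom : SurfaceGroup 3 →* SurfaceGroup 3 :=
  presentedLift ((PresentedGroup.mk _).comp (FreeGroup.lift iotaFun)) (by
    intro r hr
    rw [Set.mem_singleton_iff] at hr
    subst hr
    rw [MonoidHom.comp_apply, iotaFun_rel, map_inv, PresentedGroup.one_of_mem (Set.mem_singleton _),
      inv_one])

/-- `ι` on the class of a word. [folklore] -/
theorem iotaHom_mk (w : FreeGroup (surfaceGen 3)) :
    iotaHom (PresentedGroup.mk _ w) = PresentedGroup.mk _ (FreeGroup.lift iotaFun w) :=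
  presentedLift_mk _ _ w

/-- `ι ∘ ι = id`. [folklore] -/
theorem iotaHom_comp : iotaHom.comp iotaHom = MonoidHom.id _ :=
  PresentedGroup.ext fun x => by
    rw [MonoidHom.comp_apply, MonoidHom.id_apply, show (PresentedGroup.of x : SurfaceGroup 3) =
      PresentedGroup.mk _ (FreeGroup.of x) from rfl, iotaHom_mk, iotaHom_mk, FreeGroup.lift_apply_of,
      iotaFun_iotaFun]

/-- **The reflection `ι ∈ Aut S₃`**, an involution. [folklore] -/
def iotaEquiv : SurfaceGroup 3 ≃* SurfaceGroup 3 :=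
  MonoidHom.toMulEquiv iotaHom iotaHom iotaHom_comp iotaHom_comp

/-- `ι` has the free lift `FreeGroup.lift iotaFun`. [folklore] -/
theorem iotaEquiv_of (x : surfaceGen 3) : iotaEquiv (PresentedGroup.of x) =
    PresentedGroup.mk _ (FreeGroup.lift iotaFun (FreeGroup.of x)) :=
  iotaHom_mk (FreeGroup.of x)

/-- `ι⁻¹ = ι` has the free lift `FreeGroup.lift iotaFun`. [folklore] -/
theorem iotaEquiv_symm_of (x : surfaceGen 3) : iotaEquiv.symm (PresentedGroup.of x) =
    PresentedGroup.mk _ (FreeGroup.lift iotaFun (FreeGroup.of x)) :=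
  iotaHom_mk (FreeGroup.of x)

/-- **`ι` is a Goeritz element realising `negB`** (`aᵢ ↦ aᵢ`, `bᵢ ↦ -bᵢ` on `H₁`; it also stabilises
`N₂`, not recorded). [folklore] -/
theorem iotaEquiv_goeritz : Goeritz⟪iotaEquiv, negB⟫ :=
  ⟨map_s4Kernels_eq_of_free iotaEquiv _ _ iotaEquiv_of iotaEquiv_symm_of 0 (by decide) (by decide),
    map_s4Kernels_eq_of_free iotaEquiv _ _ iotaEquiv_of iotaEquiv_symm_of 1 (by decide) (by decide),
    realises_of_free iotaEquiv _ iotaEquiv_of negB (by decide)⟩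

/-! ## Registered sub-goal of this helper file -/

/-- **Registered sub-goal `exists_goeritz_moveX0`** (helper II of stub `stub_goeritzRealisationThree`):
the central generator `moveX 0 1` (`b₀ ↦ b₀ + a₀`) of the unipotent radical of the pair-stabiliser is
induced on `H₁` by a Goeritz element (the twist `x0`). [folklore] -/
theorem exists_goeritz_moveX0 : ∃ σ : SurfaceGroup 3 ≃* SurfaceGroup 3, (s4Kernels 0).map σ.toMonoidHom = s4Kernels 0 ∧ (s4Kernels 1).map σ.toMonoidHom = s4Kernels 1 ∧ ∀ s : SurfaceGroup 3, toAdd (SurfaceGroup.abelianize 3 (σ s)) = moveX 0 1 (toAdd (SurfaceGroup.abelianize 3 s)) :=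
  ⟨x0.toMulEquiv, x0_goeritz⟩

end Summit.SmoothPoincare4.SmoothPoincare4.Theorems.ShadowApproximation.NilpotentGenusClass

end
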